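import Literature.Barriers.AnomalousDissipation.ObukhovCorrsinThresholdProofs
import Literature.Analysis.FluidPDE.PassiveScalarForcedEnergyKinetic
import Literature.Analysis.FunctionSpaces.TorusSpaceTimeConvolution
import HarnessLib

/-!
# The Obukhov–Corrsin threshold for STEADILY SOURCED scalars (barrier audit 2026-08-17, gen 11)

Proof-support module for the barrier `Literature.Barriers.AnomalousDissipation.DrivasElgindiIyerJeong2022_thm4`
(`Barriers/AnomalousDissipation/ObukhovCorrsinThreshold`), scope caveat (ii) ("REACH IN TIME AND
FORCING"): the printed theorem and the vendored fact are unforced, whereas crux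
`ScalarAnomalySteadySourceFormal` of route TwoAndHalfD transports a scalar with a smooth STEADY
SOURCE `h`. Caveat (ii) recorded ON PAPER that a steady source adds only
`|∫ₜᵀ∫ (h - (h̄_ℓ)‾_ℓ) θ| ≤ 2ℓ^γ [h]_γ ∫ₜᵀ ‖θ‖_{L¹}` to the mollified energy budget (5.9) of
Drivas–Elgindi–Iyer–Jeong 2022. This file makes the WINDOW form of that clause a theorem:

* `DrivasElgindiIyerJeong2022_thm4_forced.two_mul_eScalarDissipation_le` — the fixed-scale bound
  (5.10) for weak solutions of `∂ₜθ + u·∇θ = κΔθ + h` (`Torus.IsWeakScalarTransportForcedOn`,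
  steady `γ`-Hölder source `h` with constant `L`) obeying the sourced energy inequality
  `‖θ(t)‖² + 2κ∫₀ᵗ‖∇θ‖² ≤ ‖θ₀‖² + 2∫₀ᵗ∫ θ h` for a.e. `t` (taken as a hypothesis, exactly as the
  unforced named fact takes (1.2); both halves at the SAME a.e. time are needed — the accepted
  `PassiveScalarForcedEnergy` / `PassiveScalarForcedEnergyKinetic` supply the dissipative and the
  kinetic half separately for `L¹ₜḢ¹ₓ` drifts) and bounded by `M` in `L^∞_t C^{0,β}`:
  `2κ∫₀ᵀ‖∇θ‖² ≤ M²ε^{2β} + 4dC₁M²K ε^{α+2β-1} + 2dC₁²TM² κε^{2β-2} + 4 L T M ε^γ`;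
* `DrivasElgindiIyerJeong2022_thm4_forced` — the optimised bound, in the quantifier shape of the
  named fact: `κ∫₀ᵀ‖∇θ‖² ≤ C (κ^{(α+2β-1)/(α+1)} + κ^{γ/(α+1)})`, `C = C(d,T,α,β,γ,K,M,L,κ₀)`;
  so above the Obukhov–Corrsin line a steady Hölder source changes nothing on a window;
* `DrivasElgindiIyerJeong2022_thm4_forced.noAnomalousScalarDissipation` — the family corollary
  (`α + 2β > 1`, `γ > 0`, `κ_j → 0`, `j`-dependent fields, sources and data with the same bounds:
  dissipation `→ 0`).

## Proof

The sourced mollified ENERGY identity is obtained from the accepted RENORMALISED mollified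
identity with datum and source
(`IsWeakScalarTransportForcedOn.ae_integral_comp_molInt_eq`, `PassiveScalarForcedRenormalized`)
applied to the renormaliser `β = Calculus.renorm M`: the mollified slices `A = θ(t) ⋆ k_ε` and
`θ₀ ⋆ k_ε` are bounded by `M` pointwise (unit-mass nonnegative kernel, `‖θ(t)‖_∞ ≤ M`), and
`renorm M (a) = a²`, `renorm M' (a) = 2a` for `|a| ≤ M` (`Torus.renorm_eq_sq`,
`Torus.renormDeriv_eq_two_mul`, `PassiveScalarForcedEnergyKinetic`/`…Energy`). Against the sourced energy inequality this leaves, besides the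
three terms of the unforced proof (cumulant of the datum, Constantin–E–Titi flux bound
`Torus.neg_integral_conv_mul_flux_le_of_holderWith`, resolved dissipation), the source defect
`2∫₀ᵗ (∫θh - ∫(θ ⋆ k)(h ⋆ k)) = 2∫₀ᵗ ∫ θ (h - (h ⋆ k) ⋆ k)` (the kernel is even:
`Torus.integral_mul_convolution_comm`), and `|h - (h ⋆ k) ⋆ k| ≤ 2Lε^γ`
(`Torus.abs_convolution_kernel_sub_self_le` twice), whence `≤ 4Lε^γ ∫₀ᵗ‖θ‖_{L¹} ≤ 4LTMε^γ`
(`ForcedCorner.integral_mul_sub_integral_conv_mul_conv_le`). The optimisation in `ε` is the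
unforced one (`scale_bound`) plus `ε^γ = c^γ κ^{γ/(α+1)}` at `ε = cκ^{1/(α+1)}`.

## References

* T. D. Drivas, T. M. Elgindi, G. Iyer, I.-J. Jeong, Arch. Ration. Mech. Anal. 243 (2022),
  Thm. 4 and its proof, §5, (5.8)–(5.10) (arXiv:1911.03271, pp. 17–18). Bib key `DrivasEtAl2022`.
* P. Constantin, W. E, E. S. Titi, Comm. Math. Phys. 165 (1994), (6)–(11). Bib key
  `ConstantinETiti1994`.
* R. J. DiPerna, P.-L. Lions, Invent. Math. 98 (1989), §II.3 (renormalised mollified identity).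
  Bib key `DiPernaLions1989Invent`.
-/

open MeasureTheory Set Filter Topology
open scoped ENNReal NNReal Convolution InnerProductSpace

noncomputable section

namespace Literature.Barriers.AnomalousDissipation

open Literature.Analysis Literature.Analysis.FunctionSpaces Literature.Analysis.FluidPDE

/-! ## Two elementary lemmas -/

namespace ForcedCorner

variable {d : Type*} [Fintype d]

/-- **Sup bound of a mollification**: if `|f| ≤ B` everywhere then `|(f ⋆ k_ε)(x)| ≤ B`
(`k_ε ≥ 0` of unit mass; `Torus.abs_integral_kernel_mul_le`). [folklore] -/
theorem abs_convolution_kernel_le {f : UnitAddTorus d → ℝ} {B ε : ℝ} (hf : ∀ y, |f y| ≤ B)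
    (hε : 0 < ε) (hε' : ε ≤ 1 / 4) (x : UnitAddTorus d) : |(f ⋆ Torus.kernel ε) x| ≤ B := by
  rw [Torus.convolution_comm_real, convolution_lsmul]
  simp only [smul_eq_mul]
  exact Torus.abs_integral_kernel_mul_le hε hε' fun y _ => hf (x - y)

/-- **The source defect of the mollified energy budget** (caveat (ii) of the barrier, the clause
`|∫(h - (h̄_ℓ)‾_ℓ)θ| ≤ 2ℓ^γ[h]_γ‖θ‖_{L¹}`): for `δ ∈ L¹` with `∫|δ| ≤ B`, a continuous
`γ`-Hölder `h` with constant `L` and the torus kernel `k = k_ε`,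
`∫ δ h - ∫ (δ ⋆ k)(h ⋆ k) ≤ 2 L ε^γ B` (move one kernel across, `∫(δ ⋆ k)(h ⋆ k) = ∫ δ ((h ⋆ k) ⋆ k)`,
and `|h - (h ⋆ k) ⋆ k| ≤ |h - h ⋆ k| + |(h - h ⋆ k) ⋆ k| ≤ 2Lε^γ`). [folklore] -/
theorem integral_mul_sub_integral_conv_mul_conv_le {δ h : UnitAddTorus d → ℝ}
    (hδ : Integrable δ volume) {B : ℝ} (hδB : ∫ x, |δ x| ≤ B) (hhc : Continuous h) {L γ : ℝ≥0}
    (hh : HolderWith L γ h) {ε : ℝ} (hε : 0 < ε) (hε' : ε ≤ 1 / 4) :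
    (∫ x, δ x * h x) - ∫ x, (δ ⋆ Torus.kernel ε) x * (h ⋆ Torus.kernel ε) x ≤
      2 * (L * ε ^ (γ : ℝ)) * B := by
  set k : UnitAddTorus d → ℝ := Torus.kernel ε with hk_def
  have hk : Torus.IsSmooth k := Torus.isSmooth_kernel hε hε'
  have hhi : Integrable h volume := hhc.integrable_unitAddTorus
  have hhk_c : Continuous (h ⋆ k) := Torus.continuous_convolution hhi hk.continuous
  have hhk_i : Integrable (h ⋆ k) volume := hhk_c.integrable_unitAddTorus
  -- move one kernel across
  have hswap : ∫ x, (δ ⋆ k) x * (h ⋆ k) x = ∫ x, δ x * ((h ⋆ k) ⋆ k) x :=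
    (Torus.integral_mul_convolution_comm hδ hhk_i hk.continuous (Torus.kernel_neg hε hε')).symm
  -- the pointwise defect
  have h1 : ∀ x, |(h ⋆ k) x - h x| ≤ L * ε ^ (γ : ℝ) := fun x =>
    Torus.abs_convolution_kernel_sub_self_le hhi hh hε hε' x
  have h2 : ∀ x, |((h ⋆ k) ⋆ k) x - (h ⋆ k) x| ≤ L * ε ^ (γ : ℝ) := by
    intro x
    have e : ((h ⋆ k) ⋆ k) x - (h ⋆ k) x = ((h ⋆ k - h) ⋆ k) x := by
      rw [Torus.sub_convolution hhk_i hhi hk.continuous, Pi.sub_apply]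
    rw [e]
    exact abs_convolution_kernel_le (fun y => by rw [Pi.sub_apply]; exact h1 y) hε hε' x
  have hpt : ∀ x, |h x - ((h ⋆ k) ⋆ k) x| ≤ 2 * (L * ε ^ (γ : ℝ)) := by
    intro x
    have : h x - ((h ⋆ k) ⋆ k) x = -(((h ⋆ k) x - h x) + (((h ⋆ k) ⋆ k) x - (h ⋆ k) x)) := by ring
    rw [this, abs_neg]
    exact (abs_add_le _ _).trans (by linarith [h1 x, h2 x])
  -- integrate
  have hhkk_c : Continuous ((h ⋆ k) ⋆ k) := Torus.continuous_convolution hhk_i hk.continuous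
  obtain ⟨C₁, hC₁⟩ := Torus.exists_forall_norm_le_of_continuous hhc
  obtain ⟨C₂, hC₂⟩ := Torus.exists_forall_norm_le_of_continuous hhkk_c
  have hi1 : Integrable (fun x => δ x * h x) volume :=
    hδ.mul_bdd hhc.aestronglyMeasurable (Eventually.of_forall hC₁)
  have hi2 : Integrable (fun x => δ x * ((h ⋆ k) ⋆ k) x) volume :=
    hδ.mul_bdd hhkk_c.aestronglyMeasurable (Eventually.of_forall hC₂)
  rw [hswap, ← integral_sub hi1 hi2]
  calc ∫ x, (δ x * h x - δ x * ((h ⋆ k) ⋆ k) x) ≤ ∫ x, |δ x| * (2 * (L * ε ^ (γ : ℝ))) := by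
        refine integral_mono (hi1.sub hi2) (hδ.abs.mul_const _) fun x => ?_
        show δ x * h x - δ x * ((h ⋆ k) ⋆ k) x ≤ |δ x| * (2 * (L * ε ^ (γ : ℝ)))
        rw [← mul_sub]
        exact (le_abs_self _).trans (by rw [abs_mul]; exact mul_le_mul_of_nonneg_left (hpt x) (abs_nonneg _))
    _ = (∫ x, |δ x|) * (2 * (L * ε ^ (γ : ℝ))) := integral_mul_const _ _
    _ ≤ B * (2 * (L * ε ^ (γ : ℝ))) := by gcongr
    _ = 2 * (L * ε ^ (γ : ℝ)) * B := by ring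

end ForcedCorner

/-! ## The dissipation bound at a fixed mollification scale, with a steady source -/

/-- **The bound (5.10) at `t = 0` for the steadily sourced equation, before optimisation in `ℓ`**
(caveat (ii) of the barrier, window form): under the hypotheses of the named fact for one
solution (`u ∈ L¹C^α` with `‖u‖_{L¹C^α} ≤ K`, `‖θ₀‖_{C^β} ≤ M`, `ess sup ‖θ(t)‖_{C^β} ≤ M`), a
continuous `γ`-Hölder steady source `h` with constant `L`, a weak solution of
`∂ₜθ + u·∇θ = κΔθ + h` obeying the sourced energy inequality
`‖θ(t)‖² + 2κ∫₀ᵗ‖∇θ‖² ≤ ‖θ₀‖² + 2∫₀ᵗ∫θh` for a.e. `t`, and a scale `0 < ε ≤ 1/4`,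
`2κ ∫₀ᵀ ‖∇θ‖²_{L²} ≤ M² ε^{2β} + 2 (2 d C₁ M² ε^{α+2β-1} K + T κ d C₁² M² ε^{2β-2}) + T · 4 L ε^γ M`,
`C₁ = Torus.gradProfileMass d`, `d = card d`. [cite: DrivasEtAl2022, proof of Thm. 4, (5.9)–(5.10)] -/
theorem DrivasElgindiIyerJeong2022_thm4_forced.two_mul_eScalarDissipation_le {d : Type*} [Fintype d]
    [DecidableEq d] {T : ℝ} (hT : 0 < T) {α β : ℝ≥0} (hβ : 0 < β) {K M : ℝ≥0}
    {u : ℝ → UnitAddTorus d → EuclideanSpace ℝ d} (hu : MemLpHolder 1 α u (Ioo 0 T))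
    (huK : eLpHolderNorm 1 α u (Ioo 0 T) ≤ K) {θ₀ : UnitAddTorus d → ℝ}
    (hθ₀ : eBoundedHolderNorm β θ₀ ≤ M) {κ : ℝ} (hκ : 0 < κ)
    {h : UnitAddTorus d → ℝ} (hhc : Continuous h) {L γ : ℝ≥0} (hh : HolderWith L γ h)
    {θ : ℝ → UnitAddTorus d → ℝ}
    (hθ : Torus.IsWeakScalarTransportForcedOn T κ u (fun _ => h) θ₀ θ)
    (henergy : ∀ᵐ t ∂((volume : Measure ℝ).restrict (Ioo 0 T)),
      (∫⁻ x, ‖θ t x‖ₑ ^ 2) + 2 * Torus.eScalarDissipation κ θ 0 t ≤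
        ENNReal.ofReal ((∫ x, θ₀ x ^ 2) + 2 * ∫ s in Ioo 0 t, ∫ x, θ s x * h x))
    (hbound : ∀ᵐ t ∂((volume : Measure ℝ).restrict (Ioo 0 T)), eBoundedHolderNorm β (θ t) ≤ M)
    {ε : ℝ} (hε : 0 < ε) (hε' : ε ≤ 1 / 4) :
    2 * Torus.eScalarDissipation κ θ 0 T ≤ ENNReal.ofReal
      ((M : ℝ) ^ 2 * ε ^ (2 * (β : ℝ)) +
        2 * ((2 * Fintype.card d * Torus.gradProfileMass d * (M : ℝ) ^ 2 * ε ^ ((α : ℝ) + 2 * β - 1)) * K +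
          T * (κ * (Fintype.card d * (Torus.gradProfileMass d ^ 2 * (M : ℝ) ^ 2 * ε ^ (2 * (β : ℝ) - 2))))) +
        T * (4 * (L * ε ^ (γ : ℝ)) * M)) := by
  set μT : Measure ℝ := (volume : Measure ℝ).restrict (Ioo 0 T) with hμT
  -- Hölder bookkeeping
  have hMtop : ((M : ℝ≥0∞)) < ⊤ := ENNReal.coe_lt_top
  have nn_le : ∀ {f : UnitAddTorus d → ℝ}, eBoundedHolderNorm β f ≤ M → HolderWith M β f ∧ Continuous f := by
    intro f hf
    have hB : MemBoundedHolder β f := lt_of_le_of_lt hf hMtop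
    refine ⟨Torus.holderWith_of_nnHolderNorm_le hB.memHolder (ENNReal.coe_le_coe.1 ?_), hB.continuous hβ⟩
    rw [hB.memHolder.coe_nnHolderNorm_eq_eHolderNorm]
    exact (eHolderNorm_le_eBoundedHolderNorm β f).trans hf
  have sup_le : ∀ {f : UnitAddTorus d → ℝ}, eBoundedHolderNorm β f ≤ M → ∀ x, |f x| ≤ M := by
    intro f hf x
    have h1 : ‖f x‖ₑ ≤ (M : ℝ≥0∞) :=
      ((enorm_le_eSupNorm f x).trans (eSupNorm_le_eBoundedHolderNorm β f)).trans hf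
    have h2 : ((‖f x‖₊ : ℝ≥0) : ℝ) ≤ M := NNReal.coe_le_coe.2 (enorm_le_coe.1 h1)
    rwa [coe_nnnorm, Real.norm_eq_abs] at h2
  -- the datum
  have hθ₀H : HolderWith M β θ₀ := (nn_le hθ₀).1
  have hθ₀c : Continuous θ₀ := (nn_le hθ₀).2
  have hθ₀i : Integrable θ₀ volume := hθ₀c.integrable_unitAddTorus
  -- the kernel and the mollified source
  set k : UnitAddTorus d → ℝ := Torus.kernel ε with hk_def
  have hk : Torus.IsSmooth k := Torus.isSmooth_kernel hε hε'
  have hhi : Integrable h volume := hhc.integrable_unitAddTorus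
  have hSc : Continuous (h ⋆ k) := Torus.continuous_convolution hhi hk.continuous
  have hconv : ∀ (δ : UnitAddTorus d → ℝ) (x : UnitAddTorus d), (δ ⋆ k) x = ∫ y, δ y * k (x - y) :=
    fun δ x => by simp only [convolution_lsmul, smul_eq_mul]
  -- sup bound of mollified slices: `|δ ⋆ k| ≤ M` once `|δ| ≤ M`
  have molInt_le : ∀ {δ : UnitAddTorus d → ℝ}, (∀ y, |δ y| ≤ M) → ∀ x, |∫ y, δ y * k (x - y)| ≤ M := by
    intro δ hδ x
    rw [← hconv]
    exact ForcedCorner.abs_convolution_kernel_le hδ hε hε' x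
  -- constants and exponent bookkeeping
  set C₁ : ℝ := Torus.gradProfileMass d with hC₁
  have hC₁0 : 0 ≤ C₁ := Torus.gradProfileMass_nonneg
  set c₁ : ℝ := 2 * Fintype.card d * C₁ * (M : ℝ) ^ 2 * ε ^ ((α : ℝ) + 2 * β - 1) with hc₁
  set c₂ : ℝ := κ * (Fintype.card d * (C₁ ^ 2 * (M : ℝ) ^ 2 * ε ^ (2 * (β : ℝ) - 2))) with hc₂
  set c₃ : ℝ := 4 * (L * ε ^ (γ : ℝ)) * M with hc₃
  have hc₁0 : 0 ≤ c₁ := by positivity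
  have hc₂0 : 0 ≤ c₂ := by positivity
  have hεγ : 0 ≤ ε ^ (γ : ℝ) := Real.rpow_nonneg hε.le _
  have hc₃0 : 0 ≤ c₃ := by positivity
  have i1 : ((M : ℝ) * ε ^ (β : ℝ)) ^ 2 = (M : ℝ) ^ 2 * ε ^ (2 * (β : ℝ)) := by
    rw [mul_pow, ← Real.rpow_natCast (ε ^ (β : ℝ)) 2, ← Real.rpow_mul hε.le]
    congr 2
    push_cast
    ring
  have i2 : ε⁻¹ * ε ^ (β : ℝ) * ε ^ (α : ℝ) * ε ^ (β : ℝ) = ε ^ ((α : ℝ) + 2 * β - 1) := by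
    rw [← Real.rpow_neg_one ε, ← Real.rpow_add hε, ← Real.rpow_add hε, ← Real.rpow_add hε]
    congr 1
    ring
  have i3 : (ε⁻¹ * ε ^ (β : ℝ)) ^ 2 = ε ^ (2 * (β : ℝ) - 2) := by
    rw [← Real.rpow_neg_one ε, ← Real.rpow_add hε, ← Real.rpow_natCast _ 2, ← Real.rpow_mul hε.le]
    congr 1
    push_cast
    ring
  -- Step 1a: the flux slice bound, for a.e. `s` (Constantin–E–Titi)
  have hslice : ∀ᵐ s ∂μT,
      -(∫ x, ((θ s) ⋆ k) x * ∫ y, θ s y *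
        (-⟪u s y, Torus.gradient k (x - y)⟫_ℝ + κ * Torus.laplacian k (x - y))) ≤
        c₁ * boundedHolderNorm α (u s) + c₂ := by
    filter_upwards [hbound, hu.1, hθ.ae_isWeaklyDivFree, hθ.ae_slice_integrable₁] with s hsM hsu hdiv hsi
    have hθsH : HolderWith M β (θ s) := (nn_le hsM).1
    have hθsc : Continuous (θ s) := (nn_le hsM).2
    have hum : AEStronglyMeasurable (u s) volume := hsi.2.1
    have huH : HolderWith (nnHolderNorm α (u s)) α (u s) := hsu.memHolder.holderWith
    have hCv : ∀ y, ‖u s y‖ ≤ (eSupNorm (u s)).toReal := fun y => by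
      rw [← toReal_enorm]
      exact ENNReal.toReal_mono hsu.eSupNorm_lt_top.ne (enorm_le_eSupNorm (u s) y)
    have hle : ((nnHolderNorm α (u s) : ℝ≥0) : ℝ) ≤ boundedHolderNorm α (u s) :=
      ENNReal.toReal_mono hsu.ne (eHolderNorm_le_eBoundedHolderNorm α (u s))
    have h := Torus.neg_integral_conv_mul_flux_le_of_holderWith hθsc hθsH hum hCv huH hdiv hε hε' hκ.le
    have hn0 : 0 ≤ ((nnHolderNorm α (u s) : ℝ≥0) : ℝ) := NNReal.coe_nonneg _
    calc _ ≤ _ := h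
      _ = c₁ * ((nnHolderNorm α (u s) : ℝ≥0) : ℝ) + c₂ := by
          rw [hc₁, hc₂, ← i2, ← i3]
          ring
      _ ≤ c₁ * boundedHolderNorm α (u s) + c₂ := by gcongr
  -- Step 1b: the source slice bound, for a.e. `s`
  have hsource : ∀ᵐ s ∂μT,
      (∫ x, θ s x * h x) - ∫ x, ((θ s) ⋆ k) x * (h ⋆ k) x ≤ 2 * (L * ε ^ (γ : ℝ)) * M := by
    filter_upwards [hbound, hθ.ae_slice_integrable₁] with s hsM hsi
    have hB : ∫ x, |θ s x| ≤ M := by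
      calc ∫ x, |θ s x| ≤ ∫ _x, (M : ℝ) := integral_mono hsi.1.abs (integrable_const _) (sup_le hsM)
        _ = M := by simp
    exact ForcedCorner.integral_mul_sub_integral_conv_mul_conv_le hsi.1 hB hhc hh hε hε'
  -- Step 1c: the time integrand of the renormalised identity, read below the cut-off
  have hptwise : ∀ᵐ s ∂μT,
      (2 * ∫ x, θ s x * h x) - ∫ x, Calculus.renormDeriv M (∫ y, θ s y * k (x - y)) *
        ((∫ y, θ s y * (-⟪u s y, Torus.gradient k (x - y)⟫_ℝ + κ * Torus.laplacian k (x - y))) +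
          ∫ y, h y * k (x - y)) =
      2 * ((∫ x, θ s x * h x) - ∫ x, ((θ s) ⋆ k) x * (h ⋆ k) x) +
        2 * -(∫ x, ((θ s) ⋆ k) x * ∫ y, θ s y *
          (-⟪u s y, Torus.gradient k (x - y)⟫_ℝ + κ * Torus.laplacian k (x - y))) := by
    filter_upwards [hbound, hθ.ae_slice_integrable₁] with s hsM hsi
    have hAc : Continuous ((θ s) ⋆ k) := Torus.continuous_convolution hsi.1 hk.continuous
    have hGc : Continuous fun x => ∫ y, θ s y *
        (-⟪u s y, Torus.gradient k (x - y)⟫_ℝ + κ * Torus.laplacian k (x - y)) :=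
      Torus.continuous_fluxIntegral hsi.1 hsi.2.1 hsi.2.2.1 hk κ
    have hAG : Integrable (fun x => ((θ s) ⋆ k) x * ∫ y, θ s y *
        (-⟪u s y, Torus.gradient k (x - y)⟫_ℝ + κ * Torus.laplacian k (x - y))) volume :=
      (hAc.mul hGc).integrable_unitAddTorus
    have hAS : Integrable (fun x => ((θ s) ⋆ k) x * (h ⋆ k) x) volume :=
      (hAc.mul hSc).integrable_unitAddTorus
    have hrew : ∀ x, Calculus.renormDeriv M (∫ y, θ s y * k (x - y)) *
        ((∫ y, θ s y * (-⟪u s y, Torus.gradient k (x - y)⟫_ℝ + κ * Torus.laplacian k (x - y))) +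
          ∫ y, h y * k (x - y)) =
        2 * (((θ s) ⋆ k) x * ∫ y, θ s y *
          (-⟪u s y, Torus.gradient k (x - y)⟫_ℝ + κ * Torus.laplacian k (x - y))) +
        2 * (((θ s) ⋆ k) x * (h ⋆ k) x) := by
      intro x
      rw [Torus.renormDeriv_eq_two_mul (molInt_le (sup_le hsM) x), ← hconv, ← hconv]
      ring
    simp_rw [hrew]
    rw [integral_add (hAG.const_mul 2) (hAS.const_mul 2), MeasureTheory.integral_const_mul,
      MeasureTheory.integral_const_mul]
    ring
  -- Step 2: the time integral of the slice bounds, in `ℝ≥0∞`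
  have hKint : ∫⁻ s in Ioo 0 T, ENNReal.ofReal (boundedHolderNorm α (u s)) ≤ K := by
    have e : ∫⁻ s in Ioo 0 T, ENNReal.ofReal (boundedHolderNorm α (u s)) = eLpHolderNorm 1 α u (Ioo 0 T) := by
      rw [eLpHolderNorm, eLpNorm_one_eq_lintegral_enorm]
      refine lintegral_congr fun s => ?_
      exact (Real.enorm_eq_ofReal ENNReal.toReal_nonneg).symm
    rw [e]
    exact huK
  have htime : ∀ t ∈ Ioo 0 T,
      ENNReal.ofReal (∫ s in Ioc 0 t, ((2 * ∫ x, θ s x * h x) -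
        ∫ x, Calculus.renormDeriv M (∫ y, θ s y * k (x - y)) *
          ((∫ y, θ s y * (-⟪u s y, Torus.gradient k (x - y)⟫_ℝ + κ * Torus.laplacian k (x - y))) +
            ∫ y, h y * k (x - y)))) ≤
        2 * (ENNReal.ofReal c₁ * K + ENNReal.ofReal c₂ * ENNReal.ofReal T) +
          ENNReal.ofReal c₃ * ENNReal.ofReal T := by
    intro t ht
    refine (ofReal_integral_le_lintegral_ofReal _).trans ?_
    refine (lintegral_mono_set (Ioc_subset_Ioo_right ht.2)).trans ?_
    have hmono : ∫⁻ s in Ioo 0 T, ENNReal.ofReal ((2 * ∫ x, θ s x * h x) -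
        ∫ x, Calculus.renormDeriv M (∫ y, θ s y * k (x - y)) *
          ((∫ y, θ s y * (-⟪u s y, Torus.gradient k (x - y)⟫_ℝ + κ * Torus.laplacian k (x - y))) +
            ∫ y, h y * k (x - y))) ≤
        ∫⁻ s in Ioo 0 T, (2 * (ENNReal.ofReal c₁ * ENNReal.ofReal (boundedHolderNorm α (u s)) +
          ENNReal.ofReal c₂) + ENNReal.ofReal c₃) := by
      refine lintegral_mono_ae (hslice.mp (hsource.mp (hptwise.mono fun s hs3 hs2 hs1 => ?_)))
      have hb0 : 0 ≤ boundedHolderNorm α (u s) := ENNReal.toReal_nonneg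
      rw [hs3]
      calc ENNReal.ofReal (2 * ((∫ x, θ s x * h x) - ∫ x, ((θ s) ⋆ k) x * (h ⋆ k) x) +
            2 * -(∫ x, ((θ s) ⋆ k) x * ∫ y, θ s y *
              (-⟪u s y, Torus.gradient k (x - y)⟫_ℝ + κ * Torus.laplacian k (x - y))))
          ≤ ENNReal.ofReal (2 * (c₁ * boundedHolderNorm α (u s) + c₂) + c₃) := by
            refine ENNReal.ofReal_le_ofReal ?_
            rw [hc₃]
            nlinarith [hs1, hs2]
        _ = 2 * (ENNReal.ofReal c₁ * ENNReal.ofReal (boundedHolderNorm α (u s)) + ENNReal.ofReal c₂) +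
            ENNReal.ofReal c₃ := by
            rw [ENNReal.ofReal_add (by positivity) hc₃0, ENNReal.ofReal_mul zero_le_two, ENNReal.ofReal_ofNat,
              ENNReal.ofReal_add (mul_nonneg hc₁0 hb0) hc₂0, ENNReal.ofReal_mul hc₁0]
    refine hmono.trans ?_
    rw [lintegral_add_right _ measurable_const, lintegral_const_mul' _ _ ENNReal.ofNat_ne_top,
      lintegral_add_right _ measurable_const, lintegral_const_mul' _ _ ENNReal.ofReal_ne_top,
      lintegral_const, lintegral_const, Measure.restrict_apply_univ, Real.volume_Ioo, sub_zero]
    gcongr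
  -- Step 3: the bound for a.e. `t`
  have hβc : ContDiff ℝ 1 (Calculus.renorm M) := (Calculus.contDiff_renorm (M : ℝ)).of_le (by simp)
  have hW : IntegrableOn (fun s => ∫ x, θ s x * h x) (Ioo 0 T) volume :=
    (hθ.integrable_mul_continuous hhc).integral_prod_left
  have hΦ : IntegrableOn (fun s => ∫ x, Calculus.renormDeriv M (∫ y, θ s y * k (x - y)) *
      ((∫ y, θ s y * (-⟪u s y, Torus.gradient k (x - y)⟫_ℝ + κ * Torus.laplacian k (x - y))) +
        ∫ y, h y * k (x - y))) (Ioo 0 T) volume := by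
    have := (hθ.integrable_comp_molInt_mul_flux hk (Calculus.continuous_renormDeriv M)
      (Calculus.abs_renormDeriv_le_const M)).integral_prod_left
    exact this
  have hmain : ∀ᵐ t ∂μT, 2 * Torus.eScalarDissipation κ θ 0 t ≤
      ENNReal.ofReal ((M : ℝ) ^ 2 * ε ^ (2 * (β : ℝ))) +
        (2 * (ENNReal.ofReal c₁ * K + ENNReal.ofReal c₂ * ENNReal.ofReal T) +
          ENNReal.ofReal c₃ * ENNReal.ofReal T) := by
    filter_upwards [henergy, hθ.ae_integral_comp_molInt_eq hθ₀i hk hβc (Calculus.lipschitzWith_renorm M),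
      ae_restrict_mem measurableSet_Ioo, hθ.ae_slice_integrable₁, hbound] with t hen hid htT hint htM
    have hsub : Ioc 0 t ⊆ Ioo 0 T := Ioc_subset_Ioo_right htT.2
    have hθti : Integrable (θ t) volume := hint.1
    have hAc : Continuous ((θ t) ⋆ k) := Torus.continuous_convolution hθti hk.continuous
    -- Young: `‖θ(t) ⋆ k‖₂ ≤ ‖θ(t)‖₂`
    have hY : ∫⁻ x, ‖((θ t) ⋆ k) x‖ₑ ^ 2 ≤ ∫⁻ x, ‖θ t x‖ₑ ^ 2 := by
      rw [← PassiveScalarProofs.eLpNorm_two_pow_two, ← PassiveScalarProofs.eLpNorm_two_pow_two]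
      gcongr
      calc eLpNorm ((θ t) ⋆ k) 2 volume ≤ (∫⁻ y, ‖k y‖ₑ) * eLpNorm (θ t) 2 volume :=
            Torus.eLpNorm_convolution_le hθti.aestronglyMeasurable hk.continuous.aestronglyMeasurable one_le_two
        _ = eLpNorm (θ t) 2 volume := by rw [hk_def, Torus.lintegral_enorm_kernel hε hε', one_mul]
    have eA : ∫⁻ x, ‖((θ t) ⋆ k) x‖ₑ ^ 2 = ENNReal.ofReal (∫ x, ((θ t) ⋆ k) x ^ 2) :=
      Torus.lintegral_enorm_sq_eq_ofReal_integral_sq hAc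
    -- the budget `B = ‖θ₀‖² + 2∫₀ᵗ∫θh`, with the time integral over `(0, t]`
    set B : ℝ := (∫ x, θ₀ x ^ 2) + 2 * ∫ s in Ioc 0 t, ∫ x, θ s x * h x with hB
    have hen' : (∫⁻ x, ‖θ t x‖ₑ ^ 2) + 2 * Torus.eScalarDissipation κ θ 0 t ≤ ENNReal.ofReal B := by
      rw [hB, integral_Ioc_eq_integral_Ioo]
      exact hen
    have h1 : ENNReal.ofReal (∫ x, ((θ t) ⋆ k) x ^ 2) + 2 * Torus.eScalarDissipation κ θ 0 t ≤
        ENNReal.ofReal B := by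
      rw [← eA]
      exact (add_le_add hY le_rfl).trans hen'
    have h2 : 2 * Torus.eScalarDissipation κ θ 0 t ≤ ENNReal.ofReal (B - ∫ x, ((θ t) ⋆ k) x ^ 2) := by
      rw [ENNReal.ofReal_sub _ (integral_nonneg fun x => sq_nonneg _)]
      exact ENNReal.le_sub_of_add_le_left ENNReal.ofReal_ne_top h1
    -- the renormalised identity is the mollified energy identity (every slice is below the cut-off)
    have hid' : ∫ x, ((θ t) ⋆ k) x ^ 2 = (∫ x, (θ₀ ⋆ k) x ^ 2) +
        ∫ s in Ioc 0 t, ∫ x, Calculus.renormDeriv M (∫ y, θ s y * k (x - y)) *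
          ((∫ y, θ s y * (-⟪u s y, Torus.gradient k (x - y)⟫_ℝ + κ * Torus.laplacian k (x - y))) +
            ∫ y, h y * k (x - y)) := by
      have e1 : ∫ x, ((θ t) ⋆ k) x ^ 2 = ∫ x, Calculus.renorm M (∫ y, θ t y * k (x - y)) :=
        integral_congr_ae (Eventually.of_forall fun x => by
          show ((θ t) ⋆ k) x ^ 2 = Calculus.renorm M (∫ y, θ t y * k (x - y))
          rw [Torus.renorm_eq_sq (molInt_le (sup_le htM) x), hconv])
      have e2 : ∫ x, (θ₀ ⋆ k) x ^ 2 = ∫ x, Calculus.renorm M (∫ y, θ₀ y * k (x - y)) :=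
        integral_congr_ae (Eventually.of_forall fun x => by
          show (θ₀ ⋆ k) x ^ 2 = Calculus.renorm M (∫ y, θ₀ y * k (x - y))
          rw [Torus.renorm_eq_sq (molInt_le (sup_le hθ₀) x), hconv])
      rw [e1, e2, hid, Calculus.deriv_renorm]
    have h3 : B - ∫ x, ((θ t) ⋆ k) x ^ 2 ≤ (M : ℝ) ^ 2 * ε ^ (2 * (β : ℝ)) +
        ∫ s in Ioc 0 t, ((2 * ∫ x, θ s x * h x) -
          ∫ x, Calculus.renormDeriv M (∫ y, θ s y * k (x - y)) *
            ((∫ y, θ s y * (-⟪u s y, Torus.gradient k (x - y)⟫_ℝ + κ * Torus.laplacian k (x - y))) +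
              ∫ y, h y * k (x - y))) := by
      rw [hid', hB, integral_sub ((hW.mono_set hsub).const_mul 2) (hΦ.mono_set hsub),
        MeasureTheory.integral_const_mul, ← i1]
      have := Torus.integral_sq_sub_integral_convolution_sq_le hθ₀c hθ₀H hε hε'
      linarith
    calc 2 * Torus.eScalarDissipation κ θ 0 t
        ≤ ENNReal.ofReal (B - ∫ x, ((θ t) ⋆ k) x ^ 2) := h2
      _ ≤ ENNReal.ofReal ((M : ℝ) ^ 2 * ε ^ (2 * (β : ℝ)) +
          ∫ s in Ioc 0 t, ((2 * ∫ x, θ s x * h x) -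
            ∫ x, Calculus.renormDeriv M (∫ y, θ s y * k (x - y)) *
              ((∫ y, θ s y * (-⟪u s y, Torus.gradient k (x - y)⟫_ℝ + κ * Torus.laplacian k (x - y))) +
                ∫ y, h y * k (x - y)))) := ENNReal.ofReal_le_ofReal h3
      _ ≤ ENNReal.ofReal ((M : ℝ) ^ 2 * ε ^ (2 * (β : ℝ))) +
          ENNReal.ofReal (∫ s in Ioc 0 t, ((2 * ∫ x, θ s x * h x) -
            ∫ x, Calculus.renormDeriv M (∫ y, θ s y * k (x - y)) *
              ((∫ y, θ s y * (-⟪u s y, Torus.gradient k (x - y)⟫_ℝ + κ * Torus.laplacian k (x - y))) +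
                ∫ y, h y * k (x - y)))) := ENNReal.ofReal_add_le
      _ ≤ _ := by
          gcongr
          exact htime t htT
  -- Step 4: from a.e. `t` to `T`
  have h2D : ∀ t, 2 * Torus.eScalarDissipation κ θ 0 t =
      ∫⁻ s in Ioo 0 t, 2 * (ENNReal.ofReal κ * Torus.eScalarGradNormSq (θ s)) := fun t => by
    rw [Torus.eScalarDissipation, ← lintegral_const_mul' _ _ ENNReal.ofReal_ne_top,
      ← lintegral_const_mul' _ _ ENNReal.ofNat_ne_top]
  have hfin : 2 * Torus.eScalarDissipation κ θ 0 T ≤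
      ENNReal.ofReal ((M : ℝ) ^ 2 * ε ^ (2 * (β : ℝ))) +
        (2 * (ENNReal.ofReal c₁ * K + ENNReal.ofReal c₂ * ENNReal.ofReal T) +
          ENNReal.ofReal c₃ * ENNReal.ofReal T) := by
    rw [h2D]
    refine setLIntegral_Ioo_le_of_ae_le hT ?_
    filter_upwards [hmain] with t ht
    rwa [h2D] at ht
  refine hfin.trans (le_of_eq ?_)
  rw [ENNReal.ofReal_add (by positivity) (by positivity), ENNReal.ofReal_add (by positivity) (by positivity),
    ENNReal.ofReal_mul zero_le_two, ENNReal.ofReal_ofNat,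
    ENNReal.ofReal_add (by positivity) (by positivity), ENNReal.ofReal_mul hc₁0, ENNReal.ofReal_coe_nnreal,
    ENNReal.ofReal_mul (le_of_lt hT), mul_comm (ENNReal.ofReal T) (ENNReal.ofReal c₂),
    ENNReal.ofReal_mul (le_of_lt hT), mul_comm (ENNReal.ofReal T) (ENNReal.ofReal c₃), add_assoc]


/-! ## The theorem in the quantifier shape of the named fact -/

/-- **The Obukhov–Corrsin threshold with a steady Hölder source, on a window** (scope caveat (ii)
of `DrivasElgindiIyerJeong2022_thm4`, now a theorem in window form): let `T > 0`, `α ∈ (0,1]`,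
`β ∈ (0,1]`, `γ ≥ 0`. For all bounds `K, M, L` and `κ₀` there is `C = C(d, T, α, β, γ, K, M, L, κ₀)`
such that: whenever `u ∈ L¹(0,T; C^{0,α})` is divergence free with `‖u‖_{L¹C^{0,α}} ≤ K`, `h` is a
continuous steady source, `γ`-Hölder with constant `L`, `‖θ₀‖_{C^{0,β}} ≤ M`, `0 < κ ≤ κ₀`, and `θ`
is a weak solution of `∂ₜθ + u·∇θ = κΔθ + h`, `θ(0) = θ₀` on `T^d × [0,T)`
(`Torus.IsWeakScalarTransportForcedOn`) obeying the sourced energy inequality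
`‖θ(t)‖²₂ + 2κ∫₀ᵗ‖∇θ‖²₂ ≤ ‖θ₀‖²₂ + 2∫₀ᵗ∫θh` for a.e. `t ∈ (0,T)` and `ess sup_t ‖θ(t)‖_{C^{0,β}} ≤ M`,
then `κ∫₀ᵀ‖∇θ‖²_{L²} ≤ C (κ^{(α+2β-1)/(α+1)} + κ^{γ/(α+1)})`. In particular, above the line
`α + 2β > 1` a steadily and Hölder-continuously sourced scalar carries no anomalous dissipation on
a window either — the source enters the mollified budget (5.9) only through
`2∫₀ᵀ∫θ(h - (h ⋆ k_ℓ) ⋆ k_ℓ) = O(ℓ^γ)`, `ℓ = κ^{1/(α+1)}`. The constant is the unforced one plus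
`2TLM c^γ`, `c = ¼κ₀^{-1/(α+1)}`. [cite: DrivasEtAl2022, Thm. 4 and §5 (5.9)–(5.10)] -/
theorem DrivasElgindiIyerJeong2022_thm4_forced :
    ∀ (d : Type) [Fintype d] [DecidableEq d] (T : ℝ) (_hT : 0 < T) (α β : ℝ≥0)
      (_hα : 0 < α ∧ α ≤ 1) (_hβ : 0 < β ∧ β ≤ 1) (γ K M L κ₀ : ℝ≥0),
      ∃ C : ℝ≥0,
        ∀ (u : ℝ → UnitAddTorus d → EuclideanSpace ℝ d) (_hu : MemLpHolder 1 α u (Ioo 0 T))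
          (_huK : eLpHolderNorm 1 α u (Ioo 0 T) ≤ K)
          (h : UnitAddTorus d → ℝ) (_hhc : Continuous h) (_hh : HolderWith L γ h)
          (θ₀ : UnitAddTorus d → ℝ) (_hθ₀ : eBoundedHolderNorm β θ₀ ≤ M)
          (κ : ℝ) (_hκ : 0 < κ) (_hκ₀ : κ ≤ κ₀)
          (θ : ℝ → UnitAddTorus d → ℝ)
          (_hθ : Torus.IsWeakScalarTransportForcedOn T κ u (fun _ => h) θ₀ θ)
          (_henergy : ∀ᵐ t ∂(volume.restrict (Ioo 0 T)),
            (∫⁻ x, ‖θ t x‖ₑ ^ 2) + 2 * Torus.eScalarDissipation κ θ 0 t ≤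
              ENNReal.ofReal ((∫ x, θ₀ x ^ 2) + 2 * ∫ s in Ioo 0 t, ∫ x, θ s x * h x))
          (_hbound : ∀ᵐ t ∂(volume.restrict (Ioo 0 T)), eBoundedHolderNorm β (θ t) ≤ M),
          Torus.eScalarDissipation κ θ 0 T ≤
            ENNReal.ofReal (C * (κ ^ (((α : ℝ) + 2 * β - 1) / (α + 1)) + κ ^ ((γ : ℝ) / ((α : ℝ) + 1)))) := by
  intro d _ _ T hT α β hα hβ γ K M L κ₀
  rcases eq_zero_or_pos κ₀ with hκ₀ | hκ₀
  · refine ⟨0, ?_⟩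
    intro u _ _ h _ _ θ₀ _ κ hκ hκκ₀
    exact absurd (hκ.trans_le hκκ₀) (by simp [hκ₀])
  -- the scale `ε = c κ^γ₁`, `γ₁ = 1/(α+1)`
  set γ₁ : ℝ := ((α : ℝ) + 1)⁻¹ with hγ₁
  have hα1pos : (0 : ℝ) < α + 1 := by positivity
  have hγ₁0 : 0 ≤ γ₁ := by positivity
  have hκ₀' : (0 : ℝ) < κ₀ := hκ₀
  set c : ℝ := 4⁻¹ * (κ₀ : ℝ) ^ (-γ₁) with hc
  have hc0 : 0 < c := by positivity
  set C₁ : ℝ := Torus.gradProfileMass d with hC₁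
  have hC₁0 : 0 ≤ C₁ := Torus.gradProfileMass_nonneg
  set Cr : ℝ := 2⁻¹ * ((M : ℝ) ^ 2 * (c ^ (2 * (β : ℝ)) * (κ₀ : ℝ) ^ ((1 - (α : ℝ)) * γ₁)) +
      (2 * (2 * Fintype.card d * C₁ * (M : ℝ) ^ 2) * K) * c ^ ((α : ℝ) + 2 * β - 1) +
      (2 * (T * (Fintype.card d * (C₁ ^ 2 * (M : ℝ) ^ 2)))) * c ^ (2 * (β : ℝ) - 2)) with hCr
  have hCr0 : 0 ≤ Cr := by positivity
  set Cs : ℝ := 2⁻¹ * (T * (4 * ((L : ℝ) * c ^ (γ : ℝ)) * M)) with hCs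
  have hCs0 : 0 ≤ Cs := by positivity
  refine ⟨(Cr + Cs).toNNReal, ?_⟩
  intro u hu huK h hhc hh θ₀ hθ₀ κ hκ hκκ₀ θ hθ henergy hbound
  set ε : ℝ := c * κ ^ γ₁ with hε_def
  have hε : 0 < ε := by positivity
  have hε' : ε ≤ 1 / 4 := by
    have h1 : κ ^ γ₁ ≤ (κ₀ : ℝ) ^ γ₁ := Real.rpow_le_rpow hκ.le (by exact_mod_cast hκκ₀) hγ₁0
    have h2 : (κ₀ : ℝ) ^ (-γ₁) * (κ₀ : ℝ) ^ γ₁ = 1 := by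
      rw [Real.rpow_neg hκ₀'.le, inv_mul_cancel₀ (Real.rpow_pos_of_pos hκ₀' γ₁).ne']
    calc ε = 4⁻¹ * ((κ₀ : ℝ) ^ (-γ₁) * κ ^ γ₁) := by rw [hε_def, hc, mul_assoc]
      _ ≤ 4⁻¹ * ((κ₀ : ℝ) ^ (-γ₁) * (κ₀ : ℝ) ^ γ₁) := by gcongr
      _ = 1 / 4 := by rw [h2]; norm_num
  have hraw := DrivasElgindiIyerJeong2022_thm4_forced.two_mul_eScalarDissipation_le hT hβ.1 hu huK hθ₀ hκ
    hhc hh hθ henergy hbound hε hε'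
  -- optimisation in `ℓ`: the three unforced terms
  have hscale := scale_bound (β := (β : ℝ)) (2 * (2 * Fintype.card d * C₁ * (M : ℝ) ^ 2) * K)
    (2 * (T * (Fintype.card d * (C₁ ^ 2 * (M : ℝ) ^ 2)))) (by exact_mod_cast hα.2) hα1pos hκ
    (by exact_mod_cast hκκ₀) hc0 hγ₁ (sq_nonneg (M : ℝ))
  -- and the source term `ε^γ = c^γ κ^{γ/(α+1)}`
  have hsrc : T * (4 * ((L : ℝ) * ε ^ (γ : ℝ)) * M) = 2 * (Cs * κ ^ ((γ : ℝ) / ((α : ℝ) + 1))) := by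
    have e : ε ^ (γ : ℝ) = c ^ (γ : ℝ) * κ ^ ((γ : ℝ) / ((α : ℝ) + 1)) := by
      rw [hε_def, Real.mul_rpow hc0.le (Real.rpow_nonneg hκ.le _), ← Real.rpow_mul hκ.le, hγ₁,
        inv_mul_eq_div]
    rw [e, hCs]
    ring
  set e₁ : ℝ := ((α : ℝ) + 2 * β - 1) / (α + 1) with he₁
  set e₂ : ℝ := (γ : ℝ) / ((α : ℝ) + 1) with he₂
  have hκe₁ : 0 ≤ κ ^ e₁ := Real.rpow_nonneg hκ.le _
  have hκe₂ : 0 ≤ κ ^ e₂ := Real.rpow_nonneg hκ.le _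
  have hreal : (M : ℝ) ^ 2 * ε ^ (2 * (β : ℝ)) +
      2 * ((2 * Fintype.card d * C₁ * (M : ℝ) ^ 2 * ε ^ ((α : ℝ) + 2 * β - 1)) * K +
        T * (κ * (Fintype.card d * (C₁ ^ 2 * (M : ℝ) ^ 2 * ε ^ (2 * (β : ℝ) - 2))))) +
      T * (4 * ((L : ℝ) * ε ^ (γ : ℝ)) * M) ≤
      2 * (((Cr + Cs).toNNReal : ℝ≥0) * (κ ^ e₁ + κ ^ e₂)) := by
    rw [Real.coe_toNNReal _ (add_nonneg hCr0 hCs0), hsrc]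
    have h3 : (M : ℝ) ^ 2 * ε ^ (2 * (β : ℝ)) +
        2 * ((2 * Fintype.card d * C₁ * (M : ℝ) ^ 2 * ε ^ ((α : ℝ) + 2 * β - 1)) * K +
          T * (κ * (Fintype.card d * (C₁ ^ 2 * (M : ℝ) ^ 2 * ε ^ (2 * (β : ℝ) - 2))))) ≤
        2 * (Cr * κ ^ e₁) := by
      rw [hCr]
      calc _ = (M : ℝ) ^ 2 * (c * κ ^ γ₁) ^ (2 * (β : ℝ)) +
            2 * (2 * Fintype.card d * C₁ * (M : ℝ) ^ 2) * K * (c * κ ^ γ₁) ^ ((α : ℝ) + 2 * β - 1) +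
            2 * (T * (Fintype.card d * (C₁ ^ 2 * (M : ℝ) ^ 2))) * (κ * (c * κ ^ γ₁) ^ (2 * (β : ℝ) - 2)) := by
            rw [hε_def]; ring
        _ ≤ _ := hscale
        _ = _ := by rw [he₁]; ring
    nlinarith [mul_nonneg hCr0 hκe₂, mul_nonneg hCs0 hκe₁]
  calc Torus.eScalarDissipation κ θ 0 T
      ≤ 2⁻¹ * (2 * Torus.eScalarDissipation κ θ 0 T) := by
        rw [← mul_assoc, ENNReal.inv_mul_cancel two_ne_zero ENNReal.ofNat_ne_top, one_mul]
    _ ≤ 2⁻¹ * ENNReal.ofReal (2 * (((Cr + Cs).toNNReal : ℝ≥0) * (κ ^ e₁ + κ ^ e₂))) := by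
        gcongr
        exact hraw.trans (ENNReal.ofReal_le_ofReal hreal)
    _ = ENNReal.ofReal (((Cr + Cs).toNNReal : ℝ≥0) * (κ ^ e₁ + κ ^ e₂)) := by
        rw [ENNReal.ofReal_mul zero_le_two, ENNReal.ofReal_ofNat, ← mul_assoc,
          ENNReal.inv_mul_cancel two_ne_zero ENNReal.ofNat_ne_top, one_mul]


/-! ## No anomalous dissipation along steadily sourced families above the line -/

/-- **No anomalous scalar dissipation above the Obukhov–Corrsin threshold, along STEADILY SOURCED
families** (window form of the forced reading of `blocks:`; from
`DrivasElgindiIyerJeong2022_thm4_forced` exactly as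
`DrivasElgindiIyerJeong2022_thm4.noAnomalousScalarDissipation` follows from the named fact): let
`α + 2β > 1`, `γ > 0`, `κ_j > 0` with `κ_j → 0`, and for each `j` let `u_j ∈ L¹(0,T; C^{0,α})` with
`‖u_j‖_{L¹C^{0,α}} ≤ K`, continuous steady sources `h_j`, `γ`-Hölder with constant `L`, data with
`‖θ₀,ⱼ‖_{C^{0,β}} ≤ M`, and weak solutions `θ_j` of `∂ₜθ + u_j·∇θ = κ_jΔθ + h_j` obeying the sourced
energy inequality and `ess sup_t ‖θ_j(t)‖_{C^{0,β}} ≤ M`. Then `κ_j∫₀ᵀ‖∇θ_j‖²_{L²} → 0`.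
[cite: DrivasEtAl2022, Thm. 4] -/
theorem DrivasElgindiIyerJeong2022_thm4_forced.noAnomalousScalarDissipation (d : Type) [Fintype d]
    [DecidableEq d] (T : ℝ) (hT : 0 < T) (α β : ℝ≥0) (hα : 0 < α ∧ α ≤ 1) (hβ : 0 < β ∧ β ≤ 1)
    (hOC : 1 < (α : ℝ) + 2 * β) (γ : ℝ≥0) (hγ : 0 < γ) (K M L : ℝ≥0)
    (u : ℕ → ℝ → UnitAddTorus d → EuclideanSpace ℝ d) (hu : ∀ j, MemLpHolder 1 α (u j) (Ioo 0 T))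
    (huK : ∀ j, eLpHolderNorm 1 α (u j) (Ioo 0 T) ≤ K)
    (h : ℕ → UnitAddTorus d → ℝ) (hhc : ∀ j, Continuous (h j)) (hh : ∀ j, HolderWith L γ (h j))
    (θ₀ : ℕ → UnitAddTorus d → ℝ) (hθ₀ : ∀ j, eBoundedHolderNorm β (θ₀ j) ≤ M)
    (κ : ℕ → ℝ) (hκ : ∀ j, 0 < κ j) (hκ₀ : Tendsto κ atTop (𝓝 0))
    (θ : ℕ → ℝ → UnitAddTorus d → ℝ)
    (hθ : ∀ j, Torus.IsWeakScalarTransportForcedOn T (κ j) (u j) (fun _ => h j) (θ₀ j) (θ j))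
    (henergy : ∀ j, ∀ᵐ t ∂(volume.restrict (Ioo 0 T)),
      (∫⁻ x, ‖θ j t x‖ₑ ^ 2) + 2 * Torus.eScalarDissipation (κ j) (θ j) 0 t ≤
        ENNReal.ofReal ((∫ x, θ₀ j x ^ 2) + 2 * ∫ s in Ioo 0 t, ∫ x, θ j s x * h j x))
    (hbound : ∀ j, ∀ᵐ t ∂(volume.restrict (Ioo 0 T)), eBoundedHolderNorm β (θ j t) ≤ M) :
    Tendsto (fun j => Torus.eScalarDissipation (κ j) (θ j) 0 T) atTop (𝓝 0) := by
  obtain ⟨C, hC⟩ := DrivasElgindiIyerJeong2022_thm4_forced d T hT α β hα hβ γ K M L 1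
  have hpos : (0 : ℝ) < α + 1 := by positivity
  have hexp₁ : 0 < ((α : ℝ) + 2 * β - 1) / (α + 1) := div_pos (by linarith) hpos
  have hexp₂ : 0 < (γ : ℝ) / ((α : ℝ) + 1) := div_pos (by exact_mod_cast hγ) hpos
  have hpow : Tendsto (fun j => κ j ^ (((α : ℝ) + 2 * β - 1) / (α + 1)) + κ j ^ ((γ : ℝ) / ((α : ℝ) + 1)))
      atTop (𝓝 0) := by
    simpa using (hκ₀.rpow_const_nhds_zero hexp₁).add (hκ₀.rpow_const_nhds_zero hexp₂)
  have hup : Tendsto (fun j => ENNReal.ofReal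
      (C * (κ j ^ (((α : ℝ) + 2 * β - 1) / (α + 1)) + κ j ^ ((γ : ℝ) / ((α : ℝ) + 1))))) atTop (𝓝 0) := by
    have := hpow.const_mul (C : ℝ)
    simp only [mul_zero] at this
    simpa using ENNReal.tendsto_ofReal this
  have hev : ∀ᶠ j in atTop, κ j ≤ 1 :=
    (hκ₀.eventually (Iic_mem_nhds one_pos)).mono fun j hj => hj
  refine tendsto_of_tendsto_of_tendsto_of_le_of_le' tendsto_const_nhds hup
    (Eventually.of_forall fun _ => bot_le) (hev.mono fun j hj => ?_)
  exact hC (u j) (hu j) (huK j) (h j) (hhc j) (hh j) (θ₀ j) (hθ₀ j) (κ j) (hκ j) (by exact_mod_cast hj)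
    (θ j) (hθ j) (henergy j) (hbound j)


end Literature.Barriers.AnomalousDissipation

end
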